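import Summits.RiemannHypothesis.RiemannHypothesis.Theorems.WeilGroundStateGroundStatesConvergeToXiStubMellinXi
import Summits.RiemannHypothesis.RiemannHypothesis.Theorems.WeilGroundStateGroundStatesConvergeToXiStubPsiDecay
import Summits.RiemannHypothesis.RiemannHypothesis.Theorems.WeilGroundStateGroundStatesConvergeToXiStubMomentsOfStrip
import Summits.RiemannHypothesis.RiemannHypothesis.Theorems.GroundStatesConvergeToXi.Negative.ConvergenceClauseNonVacuous
import Literature.NumberTheory.LFunctions.WeilExplicit
import Literature.NumberTheory.LFunctions.WeilGroundState
import HarnessLib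

/-!
# `WeilGroundState.GroundStatesConvergeToXi` — stub E4 `stub_tightWeak_of_weightedL2Limit`
(crux item stmt-RiemannHypothesis-1527, route route-RiemannHypothesis-WeilGroundState, line `Sketch`;
`--supports`)

RH-free transfer behind idea card `xi-kernel-doob-transform`.  Write `Φ(t) = 2Ψ(2t)`
(`(2 : ℂ) * LagariasMontague.Psic (2 * t)`, Riemann's kernel) and, for ground states `u_k` of Weil's
form on windows `[-a_k, a_k]` (`IsWeilGroundState (a k) (u k)`) and scalars `c_k`,
`E_k := ∫ ‖c_k u_k − Φ‖² e^{(1+δ)|t|} dt`.  If `E_k → 0` for some `δ > 0`, then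

* (T) `c_k u_k` is bounded in every weighted `L¹(e^{b|t|} dt)`, `b < 1/2`, uniformly in `k`:
  pointwise AM–GM `‖v‖ e^{b|t|} ≤ (‖v‖² e^{(1+δ)|t|} + e^{(2b−1−δ)|t|})/2` with `2b − 1 − δ < 0`,
  `‖c u‖ ≤ ‖c u − Φ‖ + ‖Φ‖`, `∫ ‖Φ‖ e^{b|t|} < ∞`, and boundedness of the convergent sequence `E_k`;
* (W) `∫ c_k u_k g → ∫ Φ g` for every test function `g`: Cauchy–Schwarz
  `‖∫ (c_k u_k − Φ) g‖ ≤ (∫ ‖c_k u_k − Φ‖²)^{1/2} (∫ ‖g‖²)^{1/2} ≤ E_k^{1/2} ‖g‖₂ → 0`.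

(T) and (W) are exactly the two hypotheses of the landed transfer
`groundStatesConvergeToXi_of_tightWeakLimit` (`…GroundStatesConvergeToXiTransfer.lean`).
Everything here is RH-free and sorry-free; no new definitions.
-/

noncomputable section

set_option linter.dupNamespace false

open scoped Topology Real
open Filter Set MeasureTheory Complex

namespace Summit.RiemannHypothesis.RiemannHypothesis.Theorems.GroundStatesConvergeToXi

open Literature.NumberTheory.LFunctions

/-! ## Elementary inequalities -/

/-- AM–GM with exponential weights: `p e^{(A+B)/2} ≤ (p² e^{A} + e^{B}) / 2`. [folklore] -/
theorem wL2_amgm (p A B : ℝ) :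
    p * Real.exp ((A + B) / 2) ≤ (p ^ 2 * Real.exp A + Real.exp B) / 2 := by
  have hA : Real.exp A = Real.exp (A / 2) * Real.exp (A / 2) := by
    rw [← Real.exp_add]; ring_nf
  have hB : Real.exp B = Real.exp (B / 2) * Real.exp (B / 2) := by
    rw [← Real.exp_add]; ring_nf
  have hAB : Real.exp ((A + B) / 2) = Real.exp (A / 2) * Real.exp (B / 2) := by
    rw [← Real.exp_add]; ring_nf
  rw [hA, hB, hAB]
  nlinarith [two_mul_le_add_sq (p * Real.exp (A / 2)) (Real.exp (B / 2))]

/-! ## Riemann's kernel and ground states in weighted spaces -/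

/-- `‖Φ‖² e^{μ|t|}` is integrable for every `μ` (`Φ` is bounded and has all exponential moments).
[folklore] -/
theorem wL2_integrable_phi_sq_weight (μ : ℝ) :
    Integrable fun t : ℝ =>
      ‖(2 : ℂ) * LagariasMontague.Psic (2 * t)‖ ^ 2 * Real.exp (μ * |t|) := by
  obtain ⟨M, hM0, hM⟩ := Negative.exists_norm_phi_le
  refine ((momentsOfStrip_expMoment_phi μ).const_mul M).mono'
    ((continuous_phi.norm.pow 2).mul (by fun_prop)).aestronglyMeasurable
    (ae_of_all _ fun t => ?_)
  rw [Real.norm_of_nonneg (by positivity), sq, mul_assoc]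
  exact mul_le_mul_of_nonneg_right (hM t) (by positivity)

/-- **Integrability of the weighted square** `‖c u − Φ‖² e^{μ|t|}` for a ground state `u` (which
vanishes a.e. off its window, where the weight is bounded), any `c : ℂ` and any rate `μ`.
[folklore] -/
theorem wL2_integrable_weight {a : ℝ} {u : ℝ → ℂ} (hu : IsWeilGroundState a u) (c : ℂ) (μ : ℝ) :
    Integrable fun t : ℝ =>
      ‖c * u t - (2 : ℂ) * LagariasMontague.Psic (2 * t)‖ ^ 2 * Real.exp (μ * |t|) := by
  have hu2 : Integrable fun t : ℝ => ‖u t‖ ^ 2 :=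
    (memLp_two_iff_integrable_sq_norm hu.memLp.1).1 hu.memLp
  have hdom : Integrable fun t : ℝ => 2 * (‖c‖ ^ 2 * ‖u t‖ ^ 2 * Real.exp (|μ| * a)) +
      2 * (‖(2 : ℂ) * LagariasMontague.Psic (2 * t)‖ ^ 2 * Real.exp (μ * |t|)) :=
    (((hu2.const_mul (‖c‖ ^ 2)).mul_const (Real.exp (|μ| * a))).const_mul 2).add
      ((wL2_integrable_phi_sq_weight μ).const_mul 2)
  have hmeas : AEStronglyMeasurable (fun t : ℝ =>
      ‖c * u t - (2 : ℂ) * LagariasMontague.Psic (2 * t)‖ ^ 2 * Real.exp (μ * |t|)) volume :=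
    (((hu.memLp.1.const_mul c).sub continuous_phi.aestronglyMeasurable).norm.pow 2).mul
      (by fun_prop : Continuous fun t : ℝ => Real.exp (μ * |t|)).aestronglyMeasurable
  refine hdom.mono' hmeas (hu.ae_eq_zero_of_notMem.mono fun t ht => ?_)
  rw [Real.norm_of_nonneg (by positivity)]
  by_cases hmem : t ∈ Icc (-a) a
  · have hta : |t| ≤ a := abs_le.2 (mem_Icc.1 hmem)
    have h1 : Real.exp (μ * |t|) ≤ Real.exp (|μ| * a) := Real.exp_le_exp.2 <|
      calc μ * |t| ≤ |μ| * |t| := mul_le_mul_of_nonneg_right (le_abs_self μ) (abs_nonneg t)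
        _ ≤ |μ| * a := mul_le_mul_of_nonneg_left hta (abs_nonneg μ)
    have h2 : ‖c‖ ^ 2 * ‖u t‖ ^ 2 * Real.exp (μ * |t|) ≤ ‖c‖ ^ 2 * ‖u t‖ ^ 2 * Real.exp (|μ| * a) :=
      mul_le_mul_of_nonneg_left h1 (by positivity)
    -- parallelogram bound `‖x − y‖² ≤ 2‖x‖² + 2‖y‖²`
    have hpar : ‖c * u t - (2 : ℂ) * LagariasMontague.Psic (2 * t)‖ ^ 2 ≤
        2 * ‖c * u t‖ ^ 2 + 2 * ‖(2 : ℂ) * LagariasMontague.Psic (2 * t)‖ ^ 2 := by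
      have hsq : ‖c * u t - (2 : ℂ) * LagariasMontague.Psic (2 * t)‖ ^ 2 ≤
          (‖c * u t‖ + ‖(2 : ℂ) * LagariasMontague.Psic (2 * t)‖) ^ 2 :=
        pow_le_pow_left₀ (norm_nonneg _) (norm_sub_le _ _) 2
      nlinarith [sq_nonneg (‖c * u t‖ - ‖(2 : ℂ) * LagariasMontague.Psic (2 * t)‖)]
    calc ‖c * u t - (2 : ℂ) * LagariasMontague.Psic (2 * t)‖ ^ 2 * Real.exp (μ * |t|)
        ≤ (2 * ‖c * u t‖ ^ 2 + 2 * ‖(2 : ℂ) * LagariasMontague.Psic (2 * t)‖ ^ 2) *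
            Real.exp (μ * |t|) :=
          mul_le_mul_of_nonneg_right hpar (Real.exp_pos _).le
      _ = 2 * (‖c‖ ^ 2 * ‖u t‖ ^ 2 * Real.exp (μ * |t|)) +
            2 * (‖(2 : ℂ) * LagariasMontague.Psic (2 * t)‖ ^ 2 * Real.exp (μ * |t|)) := by
          rw [norm_mul]; ring
      _ ≤ 2 * (‖c‖ ^ 2 * ‖u t‖ ^ 2 * Real.exp (|μ| * a)) +
            2 * (‖(2 : ℂ) * LagariasMontague.Psic (2 * t)‖ ^ 2 * Real.exp (μ * |t|)) := by
          linarith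
  · have h0 : u t = 0 := ht hmem
    have hnn : 0 ≤ ‖(2 : ℂ) * LagariasMontague.Psic (2 * t)‖ ^ 2 * Real.exp (μ * |t|) := by
      positivity
    have hnn' : 0 ≤ 2 * (‖c‖ ^ 2 * ‖u t‖ ^ 2 * Real.exp (|μ| * a)) := by positivity
    have he : ‖c * u t - (2 : ℂ) * LagariasMontague.Psic (2 * t)‖ =
        ‖(2 : ℂ) * LagariasMontague.Psic (2 * t)‖ := by
      rw [h0, mul_zero, zero_sub, norm_neg]
    rw [he]
    linarith

/-! ## (T): tightness from the weighted `L²` distance -/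

/-- **(T), one window.**  For a ground state `u`, a scalar `c` and `2b − 1 − δ < 0`:
`∫ ‖c u‖ e^{b|t|} ≤ (∫ ‖c u − Φ‖² e^{(1+δ)|t|} + ∫ e^{(2b−1−δ)|t|}) / 2 + ∫ ‖Φ‖ e^{b|t|}`
(pointwise `‖c u‖ ≤ ‖c u − Φ‖ + ‖Φ‖` and AM–GM
`‖v‖ e^{b|t|} ≤ (‖v‖² e^{(1+δ)|t|} + e^{(2b−1−δ)|t|}) / 2`). [folklore] -/
theorem wL2_tight_one {a : ℝ} {u : ℝ → ℂ} (hu : IsWeilGroundState a u) (c : ℂ) {δ b : ℝ}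
    (hb : 2 * b - 1 - δ < 0) :
    ∫ t, ‖c * u t‖ * Real.exp (b * |t|) ≤
      ((∫ t, ‖c * u t - (2 : ℂ) * LagariasMontague.Psic (2 * t)‖ ^ 2 * Real.exp ((1 + δ) * |t|)) +
          ∫ t : ℝ, Real.exp ((2 * b - 1 - δ) * |t|)) / 2 +
        ∫ t, ‖(2 : ℂ) * LagariasMontague.Psic (2 * t)‖ * Real.exp (b * |t|) := by
  have hF := wL2_integrable_weight hu c (1 + δ)
  have hE : Integrable fun t : ℝ => Real.exp ((2 * b - 1 - δ) * |t|) := by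
    have h := Literature.Analysis.Complex.integrable_exp_neg_mul_abs (b := -(2 * b - 1 - δ))
      (by linarith)
    simpa only [neg_neg] using h
  have hΦ := momentsOfStrip_expMoment_phi b
  have hFE : Integrable fun t : ℝ =>
      ‖c * u t - (2 : ℂ) * LagariasMontague.Psic (2 * t)‖ ^ 2 * Real.exp ((1 + δ) * |t|) +
        Real.exp ((2 * b - 1 - δ) * |t|) := hF.add hE
  have hFE2 := hFE.div_const 2
  have hpt : ∀ t : ℝ, ‖c * u t‖ * Real.exp (b * |t|) ≤
      (‖c * u t - (2 : ℂ) * LagariasMontague.Psic (2 * t)‖ ^ 2 * Real.exp ((1 + δ) * |t|) +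
          Real.exp ((2 * b - 1 - δ) * |t|)) / 2 +
        ‖(2 : ℂ) * LagariasMontague.Psic (2 * t)‖ * Real.exp (b * |t|) := fun t => by
    have h1 : ‖c * u t‖ ≤ ‖c * u t - (2 : ℂ) * LagariasMontague.Psic (2 * t)‖ +
        ‖(2 : ℂ) * LagariasMontague.Psic (2 * t)‖ := by
      have h := norm_add_le (c * u t - (2 : ℂ) * LagariasMontague.Psic (2 * t))
        ((2 : ℂ) * LagariasMontague.Psic (2 * t))
      rwa [sub_add_cancel] at h
    have h2 := wL2_amgm ‖c * u t - (2 : ℂ) * LagariasMontague.Psic (2 * t)‖ ((1 + δ) * |t|)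
      ((2 * b - 1 - δ) * |t|)
    have he : ((1 + δ) * |t| + (2 * b - 1 - δ) * |t|) / 2 = b * |t| := by ring
    rw [he] at h2
    have h3 : ‖c * u t‖ * Real.exp (b * |t|) ≤
        (‖c * u t - (2 : ℂ) * LagariasMontague.Psic (2 * t)‖ +
            ‖(2 : ℂ) * LagariasMontague.Psic (2 * t)‖) * Real.exp (b * |t|) :=
      mul_le_mul_of_nonneg_right h1 (Real.exp_pos _).le
    rw [add_mul] at h3
    linarith
  calc ∫ t, ‖c * u t‖ * Real.exp (b * |t|)
      ≤ ∫ t, ((‖c * u t - (2 : ℂ) * LagariasMontague.Psic (2 * t)‖ ^ 2 * Real.exp ((1 + δ) * |t|) +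
            Real.exp ((2 * b - 1 - δ) * |t|)) / 2 +
          ‖(2 : ℂ) * LagariasMontague.Psic (2 * t)‖ * Real.exp (b * |t|)) :=
        integral_mono_of_nonneg (ae_of_all _ fun t => by positivity)
          (hFE2.add hΦ) (ae_of_all _ hpt)
    _ = ((∫ t, ‖c * u t - (2 : ℂ) * LagariasMontague.Psic (2 * t)‖ ^ 2 * Real.exp ((1 + δ) * |t|)) +
            ∫ t : ℝ, Real.exp ((2 * b - 1 - δ) * |t|)) / 2 +
          ∫ t, ‖(2 : ℂ) * LagariasMontague.Psic (2 * t)‖ * Real.exp (b * |t|) := by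
        rw [integral_add hFE2 hΦ, integral_div, integral_add hF hE]

/-! ## (W): weak convergence from the weighted `L²` distance -/

/-- **(W), one window (Cauchy–Schwarz).**  For a ground state `u`, a scalar `c`, `δ ≥ 0` and a
test function `g`:
`‖∫ c u g − ∫ Φ g‖ ≤ (∫ ‖c u − Φ‖² e^{(1+δ)|t|})^{1/2} (∫ ‖g‖²)^{1/2}`. [folklore] -/
theorem wL2_weak_one {a : ℝ} {u : ℝ → ℂ} (hu : IsWeilGroundState a u) (c : ℂ) {δ : ℝ}
    (hδ : 0 ≤ δ) {g : ℝ → ℂ} (hg : IsWeilTest g) :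
    ‖(∫ t, c * u t * g t) - ∫ t, (2 : ℂ) * LagariasMontague.Psic (2 * t) * g t‖ ≤
      (∫ t, ‖c * u t - (2 : ℂ) * LagariasMontague.Psic (2 * t)‖ ^ 2 * Real.exp ((1 + δ) * |t|)) ^
          (1 / 2 : ℝ) * (∫ t, ‖g t‖ ^ 2) ^ (1 / 2 : ℝ) := by
  have hv2 : MemLp (fun t : ℝ => c * u t - (2 : ℂ) * LagariasMontague.Psic (2 * t)) 2 :=
    (hu.memLp.const_mul c).sub Negative.memLp_phi
  have hg2 : MemLp g 2 := hg.1.continuous.memLp_of_hasCompactSupport hg.2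
  have hint1 : Integrable fun t : ℝ => c * u t * g t :=
    ((hu.integrable_mul_continuous hg.1.continuous).const_mul c).congr
      (ae_of_all _ fun t => (mul_assoc _ _ _).symm)
  have hint2 : Integrable fun t : ℝ => (2 : ℂ) * LagariasMontague.Psic (2 * t) * g t :=
    (continuous_phi.mul hg.1.continuous).integrable_of_hasCompactSupport hg.2.mul_left
  have hv2i : Integrable fun t : ℝ => ‖c * u t - (2 : ℂ) * LagariasMontague.Psic (2 * t)‖ ^ 2 :=
    (memLp_two_iff_integrable_sq_norm hv2.1).1 hv2
  have hF := wL2_integrable_weight hu c (1 + δ)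
  -- Cauchy–Schwarz in `L²`
  have hCS := integral_mul_norm_le_Lp_mul_Lq (μ := volume) Real.HolderConjugate.two_two
    (by rwa [ENNReal.ofReal_ofNat] :
      MemLp (fun t : ℝ => c * u t - (2 : ℂ) * LagariasMontague.Psic (2 * t)) (ENNReal.ofReal 2))
    (by rwa [ENNReal.ofReal_ofNat] : MemLp g (ENNReal.ofReal 2))
  simp only [Real.rpow_two] at hCS
  -- the unweighted square is below the weighted one (`e^{(1+δ)|t|} ≥ 1`)
  have hle : ∫ t, ‖c * u t - (2 : ℂ) * LagariasMontague.Psic (2 * t)‖ ^ 2 ≤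
      ∫ t, ‖c * u t - (2 : ℂ) * LagariasMontague.Psic (2 * t)‖ ^ 2 * Real.exp ((1 + δ) * |t|) :=
    integral_mono hv2i hF fun t => le_mul_of_one_le_right (sq_nonneg _)
      (Real.one_le_exp (mul_nonneg (by linarith) (abs_nonneg t)))
  rw [← integral_sub hint1 hint2]
  have heq : (fun t : ℝ => c * u t * g t - (2 : ℂ) * LagariasMontague.Psic (2 * t) * g t) =
      fun t : ℝ => (c * u t - (2 : ℂ) * LagariasMontague.Psic (2 * t)) * g t := by
    funext t; ring
  rw [heq]
  calc ‖∫ t, (c * u t - (2 : ℂ) * LagariasMontague.Psic (2 * t)) * g t‖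
      ≤ ∫ t, ‖(c * u t - (2 : ℂ) * LagariasMontague.Psic (2 * t)) * g t‖ :=
        norm_integral_le_integral_norm _
    _ = ∫ t, ‖c * u t - (2 : ℂ) * LagariasMontague.Psic (2 * t)‖ * ‖g t‖ := by
        simp_rw [norm_mul]
    _ ≤ (∫ t, ‖c * u t - (2 : ℂ) * LagariasMontague.Psic (2 * t)‖ ^ 2) ^ (1 / 2 : ℝ) *
          (∫ t, ‖g t‖ ^ 2) ^ (1 / 2 : ℝ) := hCS
    _ ≤ (∫ t, ‖c * u t - (2 : ℂ) * LagariasMontague.Psic (2 * t)‖ ^ 2 *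
            Real.exp ((1 + δ) * |t|)) ^ (1 / 2 : ℝ) * (∫ t, ‖g t‖ ^ 2) ^ (1 / 2 : ℝ) :=
        mul_le_mul_of_nonneg_right
          (Real.rpow_le_rpow (integral_nonneg fun t => by positivity) hle (by norm_num))
          (Real.rpow_nonneg (integral_nonneg fun t => by positivity) _)

/-! ## The stub -/

/-- **Stub E4 — `tightWeak_of_weightedL2Limit` (RH-free; the transfer of card
`xi-kernel-doob-transform`).**  If renormalised ground states `c_k u_k` converge to Riemann's
kernel `Φ = 2Ψ(2·)` in the weighted space `L²(e^{(1+δ)|t|} dt)` for some `δ > 0`, then they are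
(T) TIGHT in every `L¹(e^{b|t|})`, `b < 1/2` (AM–GM against `e^{(2b−1−δ)|t|}`, plus
`∫ ‖Φ‖ e^{b|t|} < ∞`, and boundedness of the convergent sequence of weighted distances), and
(W) converge WEAKLY to `Φ` against test functions (Cauchy–Schwarz) — the two hypotheses of the
landed transfer `groundStatesConvergeToXi_of_tightWeakLimit`. [folklore] -/
theorem stub_tightWeak_of_weightedL2Limit :
    ∀ (δ : ℝ) (a : ℕ → ℝ) (u : ℕ → ℝ → ℂ) (c : ℕ → ℂ), 0 < δ →
      (∀ k, IsWeilGroundState (a k) (u k)) →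
      Tendsto (fun k => ∫ t, ‖c k * u k t - (2 : ℂ) * LagariasMontague.Psic (2 * t)‖ ^ 2 *
        Real.exp ((1 + δ) * |t|)) atTop (𝓝 0) →
      (∀ b : ℝ, b < 1 / 2 → ∃ M : ℝ, ∀ k, ∫ t, ‖c k * u k t‖ * Real.exp (b * |t|) ≤ M) ∧
      (∀ g : ℝ → ℂ, IsWeilTest g →
        Tendsto (fun k => ∫ t, c k * u k t * g t) atTop
          (𝓝 (∫ t, 2 * LagariasMontague.Psic (2 * t) * g t))) := by
  intro δ a u c hδ hu hlim
  refine ⟨fun b hb => ?_, fun g hg => ?_⟩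
  · -- (T): the convergent sequence `E_k` is bounded, then `wL2_tight_one`
    obtain ⟨M₀, hM₀⟩ := hlim.bddAbove_range
    refine ⟨(M₀ + ∫ t : ℝ, Real.exp ((2 * b - 1 - δ) * |t|)) / 2 +
      ∫ t, ‖(2 : ℂ) * LagariasMontague.Psic (2 * t)‖ * Real.exp (b * |t|), fun k => ?_⟩
    have hk : ∫ t, ‖c k * u k t - (2 : ℂ) * LagariasMontague.Psic (2 * t)‖ ^ 2 *
        Real.exp ((1 + δ) * |t|) ≤ M₀ := hM₀ ⟨k, rfl⟩
    have h := wL2_tight_one (hu k) (c k) (δ := δ) (b := b) (by linarith)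
    linarith
  · -- (W): `‖∫ c_k u_k g − ∫ Φ g‖ ≤ E_k^{1/2} ‖g‖₂ → 0`
    rw [tendsto_iff_norm_sub_tendsto_zero]
    have hlim' : Tendsto (fun k =>
        (∫ t, ‖c k * u k t - (2 : ℂ) * LagariasMontague.Psic (2 * t)‖ ^ 2 *
            Real.exp ((1 + δ) * |t|)) ^ (1 / 2 : ℝ) * (∫ t, ‖g t‖ ^ 2) ^ (1 / 2 : ℝ))
        atTop (𝓝 0) := by
      have h := (hlim.rpow_const (p := (1 / 2 : ℝ)) (Or.inr (by norm_num))).mul_const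
        ((∫ t, ‖g t‖ ^ 2) ^ (1 / 2 : ℝ))
      rwa [Real.zero_rpow (by norm_num), zero_mul] at h
    exact squeeze_zero (fun k => norm_nonneg _) (fun k => wL2_weak_one (hu k) (c k) hδ.le hg) hlim'

end Summit.RiemannHypothesis.RiemannHypothesis.Theorems.GroundStatesConvergeToXi

end
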